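import Mathlib
import HarnessLib

/-!
# The square root of the discriminant transforms by the sign of the permutation of the embeddings

For a number field `F`, a family `b : ι → F` and an
enumeration `e : ι ≃ Hom_ℚ(F, ℂ)`, Mathlib's `Algebra.embeddingsMatrixReindex ℚ ℂ b e` is the matrix `(σ_j(b_i))_{i,j}`
whose determinant `δ` satisfies `δ² = disc(b)` (`Algebra.discr_eq_det_embeddingsMatrixReindex_pow_two`).  An
automorphism `g` of `ℂ` permutes the embeddings, `g ∘ σ_j = σ_{π(j)}`, hence permutes the COLUMNS of the matrix, so

* **`ringEquiv_apply_det_embeddingsMatrixReindex`** — `g(δ) = sign(π) · δ`;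
* `ringEquiv_apply_det_embeddingsMatrixReindex_eq_self_iff` — for a basis (`δ ≠ 0`): `g` fixes `δ` iff `π` is even.

This is the classical statement "`√disc ∈ ℚ(roots)` is fixed exactly by the even permutations of the roots" — the
Galois group lies in `A_n` iff the discriminant is a square — in the embedding language of the CM-type files (the
quadratic character of the discriminant field `ℚ(δ)` of a non-Galois cubic `F` is the sign character of `Aut(ℂ)` on
`Hom(F, ℂ)`; used for the sextic CM fields `F·k`).  Theorems only; no definition, no `sorry`.

## References

* [Lang2002] S. Lang, *Algebra*, 3rd ed., GTM 211, VI §2 (Example: the discriminant; Galois group in `A_n` iff the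
  discriminant is a square).
-/

namespace Literature.NumberTheory.NumberFields

variable {F : Type*} [Field F] [NumberField F] {ι : Type*} [Fintype ι] [DecidableEq ι]

/-- **`g(δ) = sign(π)·δ`**: an automorphism `g` of `ℂ` permuting the embeddings `σ_j = e j` of `F` according to `π`
(`g ∘ σ_j = σ_{π j}`) multiplies the determinant `δ = det(σ_j(b_i))` of the embeddings matrix by `sign π`.
[cite: Lang2002, VI §2] -/
theorem ringEquiv_apply_det_embeddingsMatrixReindex (b : ι → F) (e : ι ≃ (F →ₐ[ℚ] ℂ)) (g : ℂ ≃+* ℂ)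
    (π : Equiv.Perm ι) (hπ : ∀ (j : ι) (a : F), g (e j a) = e (π j) a) :
    g (Algebra.embeddingsMatrixReindex ℚ ℂ b e).det =
      Equiv.Perm.sign π * (Algebra.embeddingsMatrixReindex ℚ ℂ b e).det := by
  have h1 : g (Algebra.embeddingsMatrixReindex ℚ ℂ b e).det =
      ((g : ℂ →+* ℂ).mapMatrix (Algebra.embeddingsMatrixReindex ℚ ℂ b e)).det := by
    rw [← RingHom.map_det]; rfl
  have h2 : (g : ℂ →+* ℂ).mapMatrix (Algebra.embeddingsMatrixReindex ℚ ℂ b e) =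
      (Algebra.embeddingsMatrixReindex ℚ ℂ b e).submatrix id π := by
    ext i j
    simp [Algebra.embeddingsMatrixReindex, Algebra.embeddingsMatrix, hπ]
  rw [h1, h2, Matrix.det_permute']

/-- **For a basis `b`, `g` fixes `δ = det(σ_j(b_i))` iff the permutation `π` it induces on the embeddings is even**
(`δ ≠ 0` since `δ² = disc(b) ≠ 0`). [cite: Lang2002, VI §2] -/
theorem ringEquiv_apply_det_embeddingsMatrixReindex_eq_self_iff (b : Module.Basis ι ℚ F)
    (e : ι ≃ (F →ₐ[ℚ] ℂ)) (g : ℂ ≃+* ℂ) (π : Equiv.Perm ι) (hπ : ∀ (j : ι) (a : F), g (e j a) = e (π j) a) :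
    g (Algebra.embeddingsMatrixReindex ℚ ℂ b e).det = (Algebra.embeddingsMatrixReindex ℚ ℂ b e).det ↔
      Equiv.Perm.sign π = 1 := by
  have hδ : (Algebra.embeddingsMatrixReindex ℚ ℂ b e).det ≠ 0 := by
    intro h0
    have h1 := Algebra.discr_eq_det_embeddingsMatrixReindex_pow_two ℚ ℂ b e
    rw [h0, zero_pow two_ne_zero, map_eq_zero] at h1
    exact Algebra.discr_not_zero_of_basis ℚ b h1
  rw [ringEquiv_apply_det_embeddingsMatrixReindex b e g π hπ]
  constructor
  · intro h
    have h2 : ((Equiv.Perm.sign π : ℤ) : ℂ) = 1 := by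
      have := mul_right_cancel₀ hδ (h.trans (one_mul _).symm)
      exact_mod_cast this
    rcases Int.units_eq_one_or (Equiv.Perm.sign π) with h3 | h3
    · exact h3
    · rw [h3] at h2; norm_num at h2
  · intro h
    rw [h]; simp

/-- **Odd permutation ⟹ `g(δ) = −δ`.** [cite: Lang2002, VI §2] -/
theorem ringEquiv_apply_det_embeddingsMatrixReindex_of_sign_eq_neg_one (b : ι → F) (e : ι ≃ (F →ₐ[ℚ] ℂ))
    (g : ℂ ≃+* ℂ) (π : Equiv.Perm ι) (hπ : ∀ (j : ι) (a : F), g (e j a) = e (π j) a)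
    (hodd : Equiv.Perm.sign π = -1) :
    g (Algebra.embeddingsMatrixReindex ℚ ℂ b e).det = -(Algebra.embeddingsMatrixReindex ℚ ℂ b e).det := by
  rw [ringEquiv_apply_det_embeddingsMatrixReindex b e g π hπ, hodd]
  simp

/-- **`δ² = disc(b)` is rational**: the square of the embeddings determinant lies in (the image of) `ℚ`, so `g(δ)² = δ²`
for every automorphism `g` of `ℂ` — `g(δ) = ±δ`, the sign being `sign π`. [cite: Lang2002, VI §2] -/
theorem det_embeddingsMatrixReindex_pow_two_mem_range (b : ι → F) (e : ι ≃ (F →ₐ[ℚ] ℂ)) :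
    (Algebra.embeddingsMatrixReindex ℚ ℂ b e).det ^ 2 ∈ Set.range (algebraMap ℚ ℂ) :=
  ⟨Algebra.discr ℚ b, Algebra.discr_eq_det_embeddingsMatrixReindex_pow_two ℚ ℂ b e⟩

end Literature.NumberTheory.NumberFields
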